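import Literature.MathematicalPhysics.QuantumFieldTheory.Balaban1983to89.B15Prop1CoerciveAtNormalisedDatum
import Literature.MathematicalPhysics.QuantumFieldTheory.Balaban1983to89.B15Eq177ValueInvarianceCoDivB

/-!
# `Balaban1983to89.B15Prop1CoerciveAtNormalisedDatumB` — [Balaban1989LargeFieldI] (= [B15]) p. 193, (1.77) and the sentence after it p. 194; [Balaban1989LargeFieldII] (1.9) p. 358; [Balaban1984PropagatorsII]
# (= [II]) (2.3) p. 224: (1.9) AT EVERY REGULAR BASE FIELD FROM (1.9) AT THE NORMALISED ONES, AT THE **BOND-LEVEL** (2.12) DATA OF RECORD — the print-datum edition of the one datum-bearing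
# declaration of `B15Prop1CoerciveAtNormalisedDatum` that N12's junction of record uses (`sliceCoercive_fun177std_bgMSCoPOfRecord_of_normalised`) (THEOREMS ONLY)

statement-level skeleton of published theorems with citation tags; proofs where landed; nothing here is a claim about
the Yang–Mills mass gap

Cell `pub-ymgap` (HUMAN RULINGS D-0062 ∕ D-0149), lane `pub-ymgap-dag-n12-c` g35 (R134 seat (a), N12 = [B15], s1); `--kind proof --supports` K1⁹ `stmt-QuantumFields-27364`;
count-neutral.  THEOREMS ONLY (0 `def`, 0 `instance`, 0 `sorry`).  (E1) variant (iii-b), class (β) of the lane's census-by-declaration (bus [DAGN12C-G35]).  The parent's orbit-transport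
theorem `sliceCoercive_of_normalised` is stated for an ARBITRARY gauge-invariant function `f` and is consumed as it stands; only its instance at print's function of the endpoints is re-keyed,
with the gauge invariance supplied by the lane's `B15Eq177ValueInvarianceCoDivB.fun177stdB_bgMSCoPOfRecordB_gaugeAct` (displayed range clause `hbd`, discharged for print's family in the
`_lamDatumP` corollary).

HONESTY GUARD (director-ym №338 (5)).  PURELY ADDITIVE: the (b)-keyed parent stays landed and true on its own text; no displayed premise of any consumer is deleted or weakened.

WHAT IS HERE.  ★★ `sliceCoercive_fun177stdB_bgMSCoPOfRecordB_of_normalised` (bond-datum family `bd`, clause `hbd`) · ★ `sliceCoercive_fun177stdB_bgMSCoPOfRecordB_of_normalised_lamDatumP`.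

HONEST SCOPE.  Bookkeeping; the coercivity at normalised fields is a HYPOTHESIS (`hnorm`); nothing of [15] ∕ [LF-II] asserted; count-neutral; N12 NOT discharged; K0⁷ ∕ K1⁹ NOT closed; one
finite 𝕋⁴ programme at fixed ε — nothing continuum ∕ ℝ⁴ ∕ OS; the Yang–Mills mass gap (Clay) is NOT proved by any of this.

References: [B15] = [Balaban1989LargeFieldI] p.193, (1.77) p.194; [Balaban1989LargeFieldII] (1.9) p.358; [II] = [Balaban1984PropagatorsII] (2.3) p.224; [15] = [Balaban1985Variational] (2) p.278.
-/

noncomputable section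

open Set Finset Metric Filter
open scoped BigOperators Matrix RealInnerProductSpace Real InnerProductSpace Topology

namespace Literature.MathematicalPhysics.QuantumFieldTheory.Balaban1983to89.B15Prop1CoerciveAtNormalisedDatum

open B15DeterminingSets B15DeterminingSetsB GaugeField B16Sect1Backgrounds B15Prop1Carrier B8Eq17ClassAkV1 BlockAveraging
open B15Prop1SliceTaylorCalculus
open B15Prop1ChartCalculusSU2 (E3)
open T4CubeChartGnomonic (SU2)
open B15Prop1ChartSU2 (su2Chart)
open B15Prop1SliceCoordinates (GaugeSlice ιA freeBonds)
open T4AxialGaugeSmallField (castSite boxPlaqs boxBonds)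
open B15Extension193 (extend)
open B15ShellGauge193 (shellGauge)
open B14.Eq213MaximalDomains (side)
open B14.Eq213DetSet B14.Eq216Concrete B15Sect1Instances B15Eq177GaugeInvariance B15Eq177ValueInvariance B15Eq177ValueInvarianceCoDiv B16Sect1Wilson
open Literature.MathematicalPhysics.QuantumFieldTheory.BalabanImbrieJaffe1984to88.BIJ85Eq453GaugeField
open T4Continuum
open scoped Matrix.Norms.L2Operator

/-- ★★ **(1.9) AT EVERY REGULAR BASE FIELD FROM (1.9) AT THE NORMALISED ONES, AT PRINT's FUNCTION OF THE RE-KEYED ENDPOINTS** (`f = fun177stdB (bgMSCoPOfRecordB F 2 ν Kt k′ Ω) M₁ bd Z′ k`,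
`k ≤ m + K`, any bond-datum family `bd` empty above the standing range at `(k, {Ω_j(Z′)})` — its gauge invariance is then unconditional, `fun177stdB_bgMSCoPOfRecordB_gaugeAct`); the parent's
orbit transport `sliceCoercive_of_normalised` at this `f`; twin of `sliceCoercive_fun177std_bgMSCoPOfRecord_of_normalised`.
[cite: Balaban1989LargeFieldI, p.193, (1.77) and the sentence after it p.194; Balaban1989LargeFieldII, (1.9) p.358; Balaban1984PropagatorsII, (2.3) p.224] -/
theorem sliceCoercive_fun177stdB_bgMSCoPOfRecordB_of_normalised {F : T4Family} (ν : Node00.Stage7Numerics) (Kt k' : ℕ)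
    (Ω : ℕ → Set (Site (F.P Kt) 0)) (M₁ : ℕ) (bd : ℕ → (ℕ → Set (Site (F.P Kt) 0)) → BDetSet (F.P Kt)) (Z' : Set (Site (F.P Kt) 0))
    (hd : 3 ≤ (F.P Kt).d) {k : ℕ} (hk : k ≤ (F.P Kt).m + (F.P Kt).K) (hbd : ∀ j, (F.P Kt).m + (F.P Kt).K < j → bd k (maxDomT M₁ Z') j = ∅)
    {lo hi : Fin (F.P Kt).d → ℤ} (hlohi : lo ≤ hi) {n : ℕ}
    (hn : ∀ κ, hi κ ≤ lo κ + n) (hN : ∀ κ, hi κ - lo κ + 3 < ((F.P Kt).sitesPerDir k : ℤ)) {Z Λ : Set (Site (F.P Kt) 0)}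
    (hbox : pts k Λ = (castSite '' Set.Icc lo hi : Set (Site (F.P Kt) k)))
    (hZ : (boxPlaqs (lo - 1) (hi + 1) : Set (Plaq (F.P Kt) k)) ⊆ plaqsInside (pts k Z))
    {LO HI : Fin (F.P Kt).d → ℤ} (hLO : LO ≤ lo - 1) (hHI : hi + 1 ≤ HI) {n' : ℕ} (hn' : ∀ κ, HI κ ≤ LO κ + n')
    (hn'N : n' < (F.P Kt).sitesPerDir k) (hR : (boxPlaqs LO HI : Set (Plaq (F.P Kt) k)) ⊆ plaqsInside (pts k Z))
    {ε : ℝ} (hε : 0 < ε) {ρ : ℝ}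
    (hρ : (((F.P Kt).d : ℝ) * n' + 1) * ((((F.P Kt).d - 1 : ℕ) : ℝ) * n' * ((12 * (F.P Kt).d * (n + 2) ^ 2 + 1) * ε) + 3 * (F.P Kt).d * (n + 2) ^ 2 * ε) ≤ ρ)
    (ext : GaugeField (F.P Kt) k SU2 → GaugeField (F.P Kt) k SU2) (hext : ∀ V, ext V = extend (pts k Λ) (shellGauge V lo hi) V)
    (T : Finset (PBond (F.P Kt) k)) (γ' : ℝ)
    (hnorm : ∀ V : GaugeField (F.P Kt) k SU2, PlaqSmallOn (plaqsInside (pts k (Z ∩ Λᶜ))) ε V →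
      (∀ b ∈ (boxBonds LO HI : Set (PBond (F.P Kt) k)), dist1 (ext V b) ≤ ρ) →
      ∀ X : GaugeSlice (pts k Λ) T E3, γ' * ‖X‖ ^ 2
        ≤ ⟪X, fderiv ℝ (rGrad (pts k Λ) T (sliceFn (pts k Λ) T (fun177stdB (Node00.bgMSCoPOfRecordB F 2 ν Kt k' Ω) M₁ bd Z' k) (ext V))) 0 X⟫_ℝ)
    (V : GaugeField (F.P Kt) k SU2) (hV : PlaqSmallOn (plaqsInside (pts k (Z ∩ Λᶜ))) ε V) (X : GaugeSlice (pts k Λ) T E3) :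
    γ' * ‖X‖ ^ 2 ≤ ⟪X, fderiv ℝ (rGrad (pts k Λ) T (sliceFn (pts k Λ) T (fun177stdB (Node00.bgMSCoPOfRecordB F 2 ν Kt k' Ω) M₁ bd Z' k) (ext V))) 0 X⟫_ℝ :=
  sliceCoercive_of_normalised hd hlohi hn hN hbox hZ hLO hHI hn' hn'N hR hε hρ ext hext
    (fun u W => fun177stdB_bgMSCoPOfRecordB_gaugeAct ν Kt k' Ω M₁ bd Z' hk hbd u W) T γ' hnorm V hV X

/-- ★ **THE SAME AT PRINT'S [II] (2.3) FAMILY `lamDatumP`** (no range clause left). [cite: Balaban1989LargeFieldI, p.193, (1.77) p.194; Balaban1989LargeFieldII, (1.9) p.358; Balaban1984PropagatorsII, (2.3) p.224] -/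
theorem sliceCoercive_fun177stdB_bgMSCoPOfRecordB_of_normalised_lamDatumP {F : T4Family} (ν : Node00.Stage7Numerics) (Kt k' : ℕ)
    (Ω : ℕ → Set (Site (F.P Kt) 0)) (M₁ : ℕ) (Z' : Set (Site (F.P Kt) 0))
    (hd : 3 ≤ (F.P Kt).d) {k : ℕ} (hk : k ≤ (F.P Kt).m + (F.P Kt).K)
    {lo hi : Fin (F.P Kt).d → ℤ} (hlohi : lo ≤ hi) {n : ℕ}
    (hn : ∀ κ, hi κ ≤ lo κ + n) (hN : ∀ κ, hi κ - lo κ + 3 < ((F.P Kt).sitesPerDir k : ℤ)) {Z Λ : Set (Site (F.P Kt) 0)}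
    (hbox : pts k Λ = (castSite '' Set.Icc lo hi : Set (Site (F.P Kt) k)))
    (hZ : (boxPlaqs (lo - 1) (hi + 1) : Set (Plaq (F.P Kt) k)) ⊆ plaqsInside (pts k Z))
    {LO HI : Fin (F.P Kt).d → ℤ} (hLO : LO ≤ lo - 1) (hHI : hi + 1 ≤ HI) {n' : ℕ} (hn' : ∀ κ, HI κ ≤ LO κ + n')
    (hn'N : n' < (F.P Kt).sitesPerDir k) (hR : (boxPlaqs LO HI : Set (Plaq (F.P Kt) k)) ⊆ plaqsInside (pts k Z))
    {ε : ℝ} (hε : 0 < ε) {ρ : ℝ}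
    (hρ : (((F.P Kt).d : ℝ) * n' + 1) * ((((F.P Kt).d - 1 : ℕ) : ℝ) * n' * ((12 * (F.P Kt).d * (n + 2) ^ 2 + 1) * ε) + 3 * (F.P Kt).d * (n + 2) ^ 2 * ε) ≤ ρ)
    (ext : GaugeField (F.P Kt) k SU2 → GaugeField (F.P Kt) k SU2) (hext : ∀ V, ext V = extend (pts k Λ) (shellGauge V lo hi) V)
    (T : Finset (PBond (F.P Kt) k)) (γ' : ℝ)
    (hnorm : ∀ V : GaugeField (F.P Kt) k SU2, PlaqSmallOn (plaqsInside (pts k (Z ∩ Λᶜ))) ε V →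
      (∀ b ∈ (boxBonds LO HI : Set (PBond (F.P Kt) k)), dist1 (ext V b) ≤ ρ) →
      ∀ X : GaugeSlice (pts k Λ) T E3, γ' * ‖X‖ ^ 2
        ≤ ⟪X, fderiv ℝ (rGrad (pts k Λ) T (sliceFn (pts k Λ) T (fun177stdB (Node00.bgMSCoPOfRecordB F 2 ν Kt k' Ω) M₁ lamDatumP Z' k) (ext V))) 0 X⟫_ℝ)
    (V : GaugeField (F.P Kt) k SU2) (hV : PlaqSmallOn (plaqsInside (pts k (Z ∩ Λᶜ))) ε V) (X : GaugeSlice (pts k Λ) T E3) :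
    γ' * ‖X‖ ^ 2 ≤ ⟪X, fderiv ℝ (rGrad (pts k Λ) T (sliceFn (pts k Λ) T (fun177stdB (Node00.bgMSCoPOfRecordB F 2 ν Kt k' Ω) M₁ lamDatumP Z' k) (ext V))) 0 X⟫_ℝ :=
  sliceCoercive_fun177stdB_bgMSCoPOfRecordB_of_normalised ν Kt k' Ω M₁ lamDatumP Z' hd hk (lamDatumP_eq_empty_of_range M₁ Z' hk) hlohi hn hN hbox hZ hLO hHI hn'
    hn'N hR hε hρ ext hext T γ' hnorm V hV X

end Literature.MathematicalPhysics.QuantumFieldTheory.Balaban1983to89.B15Prop1CoerciveAtNormalisedDatum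

end
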